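import Summits.CriticalPhenomena.PercolationContinuityZ3.Theorems.PercNearOneGluingNoHeavyLowerTailSahiInterpCheck

/-!
# The interpolation leaf test for Sahi's `E_n` on `{0,1}^m`, II: the tensor transform and the interpolation identity

Support file (cell `prim-sahi`, seat `prim-sahi-typer` gen 30; `--supports stmt-CriticalPhenomena-4575`).  Pure proofs (standard axioms, no `sorry`)
about the computable definitions of …`SahiInterpCheck`:

* `getD_ofFn`, `getD_extract` — reading `Array.ofFn` / slices; `enc_eq`, `enc_lt`, `enc_snoc` — keys of grid points (`finFunctionFinEquiv`);
* **`transformA_eq`** — `(transformA d H m Z)[key K] = Σ_x (Π_i H_{K_i, x_i}) · Z[key x]` (induction on `m`, last coordinate = contiguous slices);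
* **`interp_identity`** — if `Σ_y H_{k,y} B_{y,k'} = c·δ_{k,k'}` then `Σ_x (Π_i H_{K_i,x_i}) · (Σ_k γ_k Π_i B_{x_i,k_i}) = c^m · γ_K` for every
  coefficient vector `γ` (inverting the tensor-product evaluation map); `checkH_spec`;
* `bernW_grid`, **`evB_grid`** — on the grid `x/d` the scaled tensor-Bernstein form `NCopyCert.evB d γ` takes the values
  `(d^d)^{-m} · Σ_k γ_k Π_i B_{x_i,k_i}`, `B_{y,k} = y^k (d−y)^{d−k}` (`bMat`). [this work]
-/

namespace Summit.CriticalPhenomena.PercolationContinuityZ3.Theorems.SahiInterp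

open Finset OneCutCert SahiC3Cube NCopyCert SahiSymCube

/-! ## Array bookkeeping -/

/-- Reading `Array.ofFn`. [this work] -/
theorem getD_ofFn {α : Type*} {k : ℕ} (f : Fin k → α) (i : ℕ) (d : α) :
    (Array.ofFn f).getD i d = if h : i < k then f ⟨i, h⟩ else d := by
  rw [Array.getD_eq_getD_getElem?, Array.getElem?_ofFn]
  split <;> rfl

/-- Reading a slice (with default `0` outside, consistently with the whole array). [this work] -/
theorem getD_extract (Z : Array ℤ) (s P j : ℕ) (hj : j < P) : (Z.extract s (s + P)).getD j 0 = Z.getD (s + j) 0 := by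
  rw [Array.getD_eq_getD_getElem?, Array.getD_eq_getD_getElem?, Array.getElem?_extract]
  split
  · rfl
  · rename_i h
    rw [Array.getElem?_eq_none (by omega)]

/-! ## Keys -/

/-- The key, unfolded. [this work] -/
theorem enc_eq {m d : ℕ} (x : Fin m → Fin (d + 1)) : enc x = ∑ i : Fin m, (x i : ℕ) * (d + 1) ^ (i : ℕ) :=
  finFunctionFinEquiv_apply x

/-- Keys are below `(d+1)^m`. [this work] -/
theorem enc_lt {m d : ℕ} (x : Fin m → Fin (d + 1)) : enc x < (d + 1) ^ m := (finFunctionFinEquiv x).isLt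

/-- The key as an element of `Fin ((d+1)^m)` is `finFunctionFinEquiv x`. [this work] -/
theorem enc_fin {m d : ℕ} (x : Fin m → Fin (d + 1)) : (⟨enc x, enc_lt x⟩ : Fin ((d + 1) ^ m)) = finFunctionFinEquiv x := rfl

/-- Splitting off the last coordinate: `key (snoc x y) = key x + y · (d+1)^m`. [this work] -/
theorem enc_snoc {m d : ℕ} (x : Fin m → Fin (d + 1)) (y : Fin (d + 1)) :
    enc (Fin.snoc x y : Fin (m + 1) → Fin (d + 1)) = enc x + (y : ℕ) * (d + 1) ^ m := by
  rw [enc_eq, enc_eq, Fin.sum_univ_castSucc]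
  simp only [Fin.snoc_castSucc, Fin.snoc_last, Fin.val_castSucc, Fin.val_last]

/-- The empty key is `0`. [this work] -/
theorem enc_fin_zero {d : ℕ} (x : Fin 0 → Fin (d + 1)) : enc x = 0 := by
  rw [enc_eq]; rfl

/-! ## The transform computes `Σ_x (Π_i H_{K_i,x_i}) · Z[key x]` -/

/-- **Correctness of the axis-by-axis transform.** [this work] -/
theorem transformA_eq (d : ℕ) (H : Fin (d + 1) → Fin (d + 1) → ℤ) : ∀ (m : ℕ) (Z : Array ℤ) (K : Fin m → Fin (d + 1)),
    (transformA d H m Z).getD (enc K) 0 = ∑ x : Fin m → Fin (d + 1), (∏ i, H (K i) (x i)) * Z.getD (enc x) 0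
  | 0, Z, K => by
    rw [enc_fin_zero, Fintype.sum_unique, enc_fin_zero, Finset.univ_eq_empty, Finset.prod_empty, one_mul]
    rfl
  | m + 1, Z, K => by
    have hK : enc K < (d + 1) ^ (m + 1) := enc_lt K
    have hsplit : enc K = enc (Fin.init K) + (K (Fin.last m) : ℕ) * (d + 1) ^ m := by
      conv_lhs => rw [← Fin.snoc_init_self K]
      exact enc_snoc _ _
    have hlt : enc (Fin.init K) < (d + 1) ^ m := enc_lt _
    have hpos : 0 < (d + 1) ^ m := pow_pos (Nat.succ_pos d) m
    have hdiv : enc K / (d + 1) ^ m = (K (Fin.last m) : ℕ) := by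
      rw [hsplit, Nat.add_mul_div_right _ _ hpos, Nat.div_eq_of_lt hlt, zero_add]
    have hmod : enc K % (d + 1) ^ m = enc (Fin.init K) := by
      rw [hsplit, Nat.add_mul_mod_self_right, Nat.mod_eq_of_lt hlt]
    rw [transformA, getD_ofFn, dif_pos hK]
    simp only [hdiv, hmod, Fin.eta]
    rw [axisSum]
    -- each slice is the transform of the sub-table
    have hsub : ∀ y : Fin (d + 1), ((Array.ofFn fun y : Fin (d + 1) =>
        transformA d H m (Z.extract ((y : ℕ) * (d + 1) ^ m) (((y : ℕ) + 1) * (d + 1) ^ m))).getD y #[]).getD (enc (Fin.init K)) 0 =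
        ∑ x : Fin m → Fin (d + 1), (∏ i, H (Fin.init K i) (x i)) * Z.getD (enc (Fin.snoc x y : Fin (m + 1) → Fin (d + 1))) 0 := by
      intro y
      rw [getD_ofFn, dif_pos y.isLt, Fin.eta, transformA_eq d H m]
      refine Finset.sum_congr rfl fun x _ => ?_
      rw [show ((y : ℕ) + 1) * (d + 1) ^ m = (y : ℕ) * (d + 1) ^ m + (d + 1) ^ m by ring, getD_extract _ _ _ _ (enc_lt x),
        enc_snoc, Nat.add_comm ((y : ℕ) * (d + 1) ^ m) (enc x)]
    simp only [hsub, Finset.mul_sum]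
    -- regroup the double sum over `(y, x)` as the sum over `Fin (m+1) → Fin (d+1)`
    have hsnoc : ∀ (y : Fin (d + 1)) (x : Fin m → Fin (d + 1)), (Fin.snocEquiv fun _ => Fin (d + 1)) (y, x) = Fin.snoc x y :=
      fun _ _ => rfl
    rw [← (Fin.snocEquiv fun _ => Fin (d + 1)).sum_comp, Fintype.sum_prod_type]
    refine Finset.sum_congr rfl fun y _ => Finset.sum_congr rfl fun x _ => ?_
    rw [hsnoc, Fin.prod_univ_castSucc]
    simp only [Fin.snoc_castSucc, Fin.snoc_last]
    show _ = (∏ i : Fin m, H (Fin.init K i) (x i)) * H (K (Fin.last m)) y * Z.getD (enc (Fin.snoc x y : Fin (m + 1) → Fin (d + 1))) 0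
    ring

/-! ## The interpolation identity -/

/-- `Π_i (c if K_i = k_i else 0) = c^m` if `K = k`, else `0`. [this work] -/
theorem prod_ite_eq_pow {m d : ℕ} (c : ℤ) (K k : Fin m → Fin (d + 1)) :
    (∏ i : Fin m, (if K i = k i then c else 0)) = if K = k then c ^ m else 0 := by
  by_cases h : K = k
  · subst h; simp
  · rw [if_neg h]
    obtain ⟨i, hi⟩ := Function.ne_iff.1 h
    exact Finset.prod_eq_zero (Finset.mem_univ i) (if_neg hi)

/-- **THE INTERPOLATION IDENTITY**: if `Σ_y H_{k,y} B_{y,k'} = c·δ_{k,k'}`, then for every coefficient vector `γ`,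
`Σ_x (Π_i H_{K_i,x_i}) · (Σ_k γ_k Π_i B_{x_i,k_i}) = c^m · γ_K`. [this work] -/
theorem interp_identity {m d : ℕ} {H : Fin (d + 1) → Fin (d + 1) → ℤ} {c : ℤ}
    (hH : ∀ k k' : Fin (d + 1), (∑ y : Fin (d + 1), H k y * bMat d y k') = if k = k' then c else 0)
    (γ : (Fin m → Fin (d + 1)) → ℤ) (K : Fin m → Fin (d + 1)) :
    (∑ x : Fin m → Fin (d + 1), (∏ i, H (K i) (x i)) * ∑ k : Fin m → Fin (d + 1), γ k * ∏ i, bMat d (x i) (k i)) = c ^ m * γ K := by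
  calc (∑ x : Fin m → Fin (d + 1), (∏ i, H (K i) (x i)) * ∑ k : Fin m → Fin (d + 1), γ k * ∏ i, bMat d (x i) (k i))
      = ∑ x : Fin m → Fin (d + 1), ∑ k : Fin m → Fin (d + 1), γ k * ∏ i, (H (K i) (x i) * bMat d (x i) (k i)) := by
        refine Finset.sum_congr rfl fun x _ => ?_
        rw [Finset.mul_sum]
        refine Finset.sum_congr rfl fun k _ => ?_
        rw [Finset.prod_mul_distrib]; ring
    _ = ∑ k : Fin m → Fin (d + 1), γ k * ∑ x : Fin m → Fin (d + 1), ∏ i, (H (K i) (x i) * bMat d (x i) (k i)) := by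
        rw [Finset.sum_comm]
        refine Finset.sum_congr rfl fun k _ => ?_
        rw [Finset.mul_sum]
    _ = ∑ k : Fin m → Fin (d + 1), γ k * ∏ i, ∑ y : Fin (d + 1), H (K i) y * bMat d y (k i) := by
        refine Finset.sum_congr rfl fun k _ => ?_
        congr 1
        rw [Finset.prod_univ_sum]
        simp only [Fintype.piFinset_univ]
    _ = ∑ k : Fin m → Fin (d + 1), γ k * (if K = k then c ^ m else 0) := by
        refine Finset.sum_congr rfl fun k _ => ?_
        rw [← prod_ite_eq_pow c K k]
        simp only [hH]
    _ = c ^ m * γ K := by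
        simp only [mul_ite, mul_zero, Finset.sum_ite_eq, Finset.mem_univ, if_true]
        ring

/-- `checkH` certifies the hypothesis of `interp_identity`. [this work] -/
theorem checkH_spec {d : ℕ} {H : Fin (d + 1) → Fin (d + 1) → ℤ} {c : ℤ} (h : checkH d H c = true) :
    ∀ k k' : Fin (d + 1), (∑ y : Fin (d + 1), H k y * bMat d y k') = if k = k' then c else 0 := by
  unfold checkH at h
  exact of_decide_eq_true h

/-! ## Bernstein values on the grid -/

/-- `d^d · bernW d (y/d) k = y^k (d − y)^{d−k}` for `k ≤ d`, `0 < d`. [this work] -/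
theorem bernW_grid {d : ℕ} (hd : 0 < d) (y k : Fin (d + 1)) :
    (d : ℝ) ^ d * bernW d ((y : ℕ) / (d : ℝ)) (k : ℕ) = ((bMat d y k : ℤ) : ℝ) := by
  have hd' : (d : ℝ) ≠ 0 := by exact_mod_cast hd.ne'
  have hk : (k : ℕ) ≤ d := Nat.lt_succ_iff.1 k.isLt
  unfold bernW bMat
  push_cast
  have h1 : (1 : ℝ) - (y : ℕ) / (d : ℝ) = ((d : ℝ) - (y : ℕ)) / d := by field_simp
  rw [h1, div_pow, div_pow]
  have hsplit : (d : ℝ) ^ d = (d : ℝ) ^ (k : ℕ) * (d : ℝ) ^ (d - k) := by rw [← pow_add, Nat.add_sub_cancel' hk]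
  rw [hsplit]
  field_simp

/-- **Grid values of `evB` are the integer combinations `Σ_k γ_k Π_i B_{x_i,k_i}`** (scaled by `(d^d)^m`). [this work] -/
theorem evB_grid {m d : ℕ} (hd : 0 < d) (γ : (Fin m → Fin (d + 1)) → ℤ) (x : Fin m → Fin (d + 1)) :
    ((d : ℝ) ^ d) ^ m * evB d γ (fun i => ((x i : ℕ) : ℝ) / d) = ((∑ k : Fin m → Fin (d + 1), γ k * ∏ i, bMat d (x i) (k i) : ℤ) : ℝ) := by
  unfold evB
  push_cast
  rw [Finset.mul_sum]
  refine Finset.sum_congr rfl fun k _ => ?_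
  have hprod : ((d : ℝ) ^ d) ^ m * ∏ i, bernW d (((x i : ℕ) : ℝ) / d) (k i) = ∏ i, ((bMat d (x i) (k i) : ℤ) : ℝ) := by
    have hc : ((d : ℝ) ^ d) ^ m = ∏ _i : Fin m, (d : ℝ) ^ d := by
      rw [Finset.prod_const, Finset.card_univ, Fintype.card_fin]
    rw [hc, ← Finset.prod_mul_distrib]
    exact Finset.prod_congr rfl fun i _ => bernW_grid hd (x i) (k i)
  rw [← hprod]
  ring

end Summit.CriticalPhenomena.PercolationContinuityZ3.Theorems.SahiInterp
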